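import Literature.Computability.Learning.PAC
import Literature.Computability.Complexity.OraclePrefixPost
import Literature.Computability.Complexity.OracleCompositionMachine
import Literature.Computability.Complexity.TruthTableFunctions
import Literature.Computability.Complexity.PlumbingBricks
import Literature.Computability.Complexity.UnaryBricks
import Literature.Computability.Complexity.FPStringBricks
import Literature.Computability.Complexity.HashBricks
import HarnessLib

/-!
# A uniform PRF distinguisher built from a polynomial-time PAC learner: the machine

Machine layer of the proof of the named fact
`Literature.Computability.Learning.prf_not_polyPACPredictable` (`CryptoHardness.lean`;
Goldreich–Goldwasser–Micali 1986, §3; Kearns–Valiant 1994, §3; Oliveira–Santhanam 2017, §4,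
Prop. 1: "learning `𝔠` implies no PRFs in `𝔠`"). From a learner `A : OracleAlg (List Bool)` and
an evaluator `E : OracleAlg Bool` (the data of `Learning.PolyPACPredictable`) we BUILD a
probabilistic polynomial-time oracle adversary `distinguisher A E qA P₁ P₂ : OracleAdversary Bool`
(C4a model of `Cryptography/OracleGames.lean`) and compute its deterministic run against an
arbitrary oracle `𝒪` (`run_distinguisher`): on `1ⁿ` with coins `r` it

1. parses `r = g₁ g₂ ρ S` and GUESSES the learner's coin budget `m' = ⟦g₁⟧ < 2^{L₁}` and the
   evaluation budget `T₂' = ⟦g₂⟧ < 2^{L₂}` (`Lᵢ = ⌊log₂ (Pᵢ(n)+1)⌋ + 1`; the budgets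
   `coins n a b`, `t₂ n a b` of `PolyPACPredictable` are arbitrary polynomially BOUNDED functions,
   not computable ones, so a uniform adversary can only guess them — each guess is right with
   probability `≥ 1 / (2 (Pᵢ(n)+1))`);
2. draws two test examples `z₀, z₁` (blocks `0, 1` of `S`) with their labels `𝒪(zᵢ)₀`;
3. runs the clocked learner `A.clock qA []` on `x_A = ⟨⟨1ⁿ, ⟨1⁸, 1⁸⟩⟩, ρ ↾ m'⟩` (accuracy and
   confidence `1/8`), answering its `j`-th query by a membership query to `𝒪` if it has the form
   `1y`, `|y| = n`, and by the labelled example (block `j + 2` of `S`, its `𝒪`-label) otherwise —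
   exactly the oracle `pacOracle true` of `PAC.lean` for the Boolean function `y ↦ 𝒪(y)₀` and the
   sample points read off `S`;
4. accepts iff `(h(z₀) = ℓ₀) ↔ (h(z₁) = ℓ₁)` for the hypothesis `h = evalHyp E T₂' w` of the
   learner's output `w` (a two-sided test: it accepts with probability `≥ 1/2` whatever the
   hypothesis, which is what makes wrong guesses harmless).

No Turing machine is programmed: the step function is assembled from the tree's combinators —
`clock`, `comap`, `mapQuery` (`OracleQueryMap.lean`), `prefixShift`, `postOut`
(`OraclePrefixPost.lean`), `OracleComposition.compose` with the one-query truth-table transducer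
`ttFnAlg` (`TruthTableFunctions.lean`) translating intermediate queries into `𝒪`-queries — and
`FP` string bricks (`BrickAlgebra`, `PlumbingBricks`, `UnaryBricks`, `FPStringBricks`,
`HashBricks`; the hypothesis evaluations are `runEmptyLang E ∈ P`). The probabilistic analysis
is in `CryptoHardnessGames.lean`.

## References

* O. Goldreich, S. Goldwasser, S. Micali, *How to construct random functions*, J. ACM 33 (1986)
  792–807, §3 [GoldreichGoldwasserMicali1986].
* M. Kearns, L. Valiant, *Cryptographic limitations on learning Boolean formulae and finite
  automata*, J. ACM 41 (1994) 67–95, §3 [KearnsValiant1994].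
* I. C. Oliveira, R. Santhanam, *Conspiracies between learning algorithms, circuit lower bounds,
  and pseudorandomness*, CCC 2017 (arXiv:1611.01190), §4, Prop. 1 [OliveiraSanthanam2017].
* S. Arora, B. Barak, *Computational Complexity: A Modern Approach*, CUP 2009, §3.4, §1.3
  [AroraBarak2009].
-/

noncomputable section

/-! ### Indexed runs with their final transcript -/

namespace Literature.Computability.Complexity

open _root_.Computability

namespace OracleAlg

variable {β : Type}

/-- Indexed runner returning the output together with the transcript at output time.
[Arora–Barak 2009, §3.4] [folklore] -/
def runIdxT (M : OracleAlg β) (O : ℕ → List Bool → List Bool) (x : List Bool) :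
    ℕ → List (List Bool) → Option (β × List (List Bool))
  | 0, _ => none
  | k + 1, as =>
    match M.step x as with
    | Sum.inl q => runIdxT M O x k (as ++ [O as.length q])
    | Sum.inr b => some (b, as)

/-- One round of `runIdxT`. [folklore] -/
theorem runIdxT_succ (M : OracleAlg β) (O : ℕ → List Bool → List Bool) (x : List Bool) (k : ℕ)
    (as : List (List Bool)) :
    M.runIdxT O x (k + 1) as =
      match M.step x as with
      | Sum.inl q => M.runIdxT O x k (as ++ [O as.length q])
      | Sum.inr b => some (b, as) :=
  rfl

/-- One round of `runIdxAux`. [folklore] -/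
theorem runIdxAux_succ' (M : OracleAlg β) (O : ℕ → List Bool → List Bool) (x : List Bool) (k : ℕ)
    (as : List (List Bool)) :
    M.runIdxAux O x (k + 1) as =
      match M.step x as with
      | Sum.inl q => M.runIdxAux O x k (as ++ [O as.length q])
      | Sum.inr b => some b :=
  rfl

/-- `runIdxAux` is the first component of `runIdxT`. [folklore] -/
theorem runIdxAux_eq_map_runIdxT (M : OracleAlg β) (O : ℕ → List Bool → List Bool) (x : List Bool) :
    ∀ (k : ℕ) (as : List (List Bool)), M.runIdxAux O x k as = (M.runIdxT O x k as).map Prod.fst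
  | 0, _ => rfl
  | k + 1, as => by
    rw [runIdxAux_succ', runIdxT_succ]
    cases M.step x as with
    | inl q => exact runIdxAux_eq_map_runIdxT M O x k _
    | inr b => rfl

/-- The final transcript extends the initial one. [folklore] -/
theorem prefix_of_runIdxT (M : OracleAlg β) (O : ℕ → List Bool → List Bool) (x : List Bool) :
    ∀ (k : ℕ) (as : List (List Bool)) (p : β × List (List Bool)), M.runIdxT O x k as = some p → as <+: p.2
  | 0, _, _, h => by simp [runIdxT] at h
  | k + 1, as, p, h => by
    rw [runIdxT_succ] at h
    cases hs : M.step x as with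
    | inl q =>
      rw [hs] at h
      obtain ⟨t, ht⟩ := prefix_of_runIdxT M O x k _ p h
      exact ⟨[O as.length q] ++ t, by rw [← List.append_assoc]; exact ht⟩
    | inr b =>
      rw [hs] at h
      cases h
      exact List.prefix_rfl

/-- `comap` under `runIdxT`. [folklore] -/
theorem runIdxT_comap (M : OracleAlg β) (pre : List Bool → List Bool) (O : ℕ → List Bool → List Bool)
    (w : List Bool) : ∀ (k : ℕ) (as : List (List Bool)), (M.comap pre).runIdxT O w k as = M.runIdxT O (pre w) k as
  | 0, _ => rfl
  | k + 1, as => by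
    rw [runIdxT_succ, runIdxT_succ, comap_step]
    cases M.step (pre w) as with
    | inl q => exact runIdxT_comap M pre O w k _
    | inr b => rfl

/-- `postOut` under `runIdxT`: same transcript, post-processed output. [folklore] -/
theorem runIdxT_postOut (M : OracleAlg (List Bool)) (h : List Bool → List Bool) (O : ℕ → List Bool → List Bool)
    (x : List Bool) : ∀ (k : ℕ) (as : List (List Bool)),
      (M.postOut h).runIdxT O x k as = (M.runIdxT O x k as).map fun p =>
        ((h (boolPair x (boolPair ((encodingList Bool).listBool.encode p.2) p.1))).headD false, p.2)
  | 0, _ => rfl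
  | k + 1, as => by
    rw [runIdxT_succ, runIdxT_succ, postOut_step]
    cases M.step x as with
    | inl q => exact runIdxT_postOut M h O x k _
    | inr b => rfl

/-- `prefixShift` under `runIdxT`, once the `k` blank answers are in: `M` runs against the index-shifted
oracle on the later answers, the first `k` answers staying in front of the transcript. [folklore] -/
theorem runIdxT_prefixShift_of_le (M : OracleAlg β) (k : ℕ) (O : ℕ → List Bool → List Bool) (x : List Bool) :
    ∀ (n : ℕ) (as : List (List Bool)), k ≤ as.length →
      (M.prefixShift k).runIdxT O x n as =
        (M.runIdxT (fun i => O (i + k)) x n (as.drop k)).map fun p => (p.1, as.take k ++ p.2)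
  | 0, _, _ => rfl
  | n + 1, as, h => by
    rw [runIdxT_succ, runIdxT_succ, prefixShift_step, if_neg (by omega)]
    cases M.step x (as.drop k) with
    | inr b => simp
    | inl q =>
      dsimp only
      rw [runIdxT_prefixShift_of_le M k O x n (as ++ [O as.length q]) (by simp; omega),
        List.drop_append_of_le_length h, List.take_append_of_le_length h, List.length_drop,
        Nat.sub_add_cancel h]

/-- `prefixShift` under `runIdxT`, blank rounds. [folklore] -/
theorem runIdxT_prefixShift_of_lt (M : OracleAlg β) (k : ℕ) (O : ℕ → List Bool → List Bool) (x : List Bool)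
    (n : ℕ) {as : List (List Bool)} (h : as.length < k) :
    (M.prefixShift k).runIdxT O x (n + 1) as = (M.prefixShift k).runIdxT O x n (as ++ [O as.length []]) := by
  rw [runIdxT_succ, prefixShift_step, if_pos h]

/-- **The clocked algorithm under `runIdxT`**: it outputs what `M` outputs within the remaining budget
(default `b₀` otherwise), with some final transcript. [Arora–Barak 2009, §3.4] [folklore] -/
theorem exists_runIdxT_clockBy (M : OracleAlg β) (t : List Bool → ℕ) (b₀ : β) (O : ℕ → List Bool → List Bool)
    (w : List Bool) : ∀ (n : ℕ) (as : List (List Bool)), as.length ≤ t w → t w - as.length < n →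
      ∃ asF, (M.clockBy t b₀).runIdxT O w n as = some ((M.runIdxAux O w (t w - as.length) as).getD b₀, asF)
  | 0, _, _, h => absurd h (Nat.not_lt_zero _)
  | n + 1, as, hle, hlt => by
    rw [runIdxT_succ, clockBy_step]
    by_cases hc : as.length < t w
    · rw [if_pos hc]
      obtain ⟨m, hm⟩ : ∃ m, t w - as.length = m + 1 := ⟨t w - as.length - 1, by omega⟩
      rw [hm, runIdxAux_succ']
      cases M.step w as with
      | inr b => exact ⟨as, rfl⟩
      | inl y =>
        have h1 : (as ++ [O as.length y]).length ≤ t w := by simp; omega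
        have h2 : t w - (as ++ [O as.length y]).length < n := by simp; omega
        obtain ⟨asF, hF⟩ := exists_runIdxT_clockBy M t b₀ O w n _ h1 h2
        have hm' : t w - (as ++ [O as.length y]).length = m := by simp; omega
        rw [hm'] at hF
        exact ⟨asF, hF⟩
    · rw [if_neg hc]
      have h0 : t w - as.length = 0 := by omega
      refine ⟨as, ?_⟩
      rw [h0]
      rfl

/-- **Rewriting queries by a map that reads only the NUMBER of earlier answers** turns a plain run
into an indexed run: if `d ⟨x, ⟨listBool as, q⟩⟩ = δ |as| q` then `M.mapQuery d` against `O` runs as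
`M` against the indexed oracle `(i, q) ↦ O (δ i q)`. [Arora–Barak 2009, §3.4] [folklore] -/
theorem runAux_mapQuery_of_index (M : OracleAlg β) (d : List Bool → List Bool) (δ : ℕ → List Bool → List Bool)
    (O : Oracle) (x : List Bool)
    (hd : ∀ (as : List (List Bool)) (q : List Bool),
      d (boolPair x (boolPair ((encodingList Bool).listBool.encode as) q)) = δ as.length q) :
    ∀ (n : ℕ) (as : List (List Bool)),
      (M.mapQuery d).runAux O x n as = M.runIdxAux (fun i q => O (δ i q)) x n as
  | 0, _ => rfl
  | n + 1, as => by
    rw [runAux_succ, runIdxAux_succ', mapQuery_step]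
    cases M.step x as with
    | inr b => rfl
    | inl q =>
      dsimp only
      rw [hd, runAux_mapQuery_of_index M d δ O x hd n]

/-- Every query of `M.mapQuery d` is a rewritten query. [folklore] -/
theorem exists_eq_of_mem_queriesAux_mapQuery (M : OracleAlg β) (d : List Bool → List Bool) (O : Oracle)
    (x : List Bool) : ∀ (n : ℕ) (as : List (List Bool)) (u : List Bool), u ∈ (M.mapQuery d).queriesAux O x n as →
      ∃ (as' : List (List Bool)) (q : List Bool), u = d (boolPair x (boolPair ((encodingList Bool).listBool.encode as') q))
  | 0, _, _, h => by simp [queriesAux] at h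
  | n + 1, as, u, h => by
    unfold queriesAux at h
    rw [mapQuery_step] at h
    cases hs : M.step x as with
    | inr b => rw [hs] at h; simp at h
    | inl q =>
      rw [hs] at h
      rcases List.mem_cons.1 h with rfl | h
      · exact ⟨as, q, rfl⟩
      · exact exists_eq_of_mem_queriesAux_mapQuery M d O x n _ u h

/-- The number of queries of a run is at most the number of rounds in which the clock allows `M` to
move: a clocked algorithm asks at most `t x - |as|` queries from transcript `as`. [folklore] -/
theorem length_queriesAux_clockBy_le (M : OracleAlg β) (t : List Bool → ℕ) (b₀ : β) (O : Oracle) (x : List Bool) :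
    ∀ (n : ℕ) (as : List (List Bool)), ((M.clockBy t b₀).queriesAux O x n as).length ≤ t x - as.length
  | 0, _ => by simp [queriesAux]
  | n + 1, as => by
    unfold queriesAux
    rw [clockBy_step]
    by_cases hc : as.length < t x
    · rw [if_pos hc]
      cases M.step x as with
      | inr b => simp
      | inl q =>
        have ih := length_queriesAux_clockBy_le M t b₀ O x n (as ++ [O q])
        simp only [List.length_cons, List.length_append] at ih ⊢
        omega
    · rw [if_neg hc]; simp

end OracleAlg

end Literature.Computability.Complexity

/-! ### The layout of the coins and the guesses -/

namespace Literature.Computability.Learning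

open _root_.Computability Complexity Complexity.OracleAlg Polynomial

namespace LearnerDistinguisher

/-- The guess length `L(P, n) = ⌊log₂ (P(n) + 1)⌋ + 1`: `L` uniform bits cover `[0, P(n)]` and take each
value with probability `≥ 1 / (2 (P(n)+1))`. [folklore] -/
def guessLen (P : Polynomial ℕ) (n : ℕ) : ℕ := Nat.log 2 (P.eval n + 1) + 1

/-- `P(n) < 2^{L(P,n)}`. [folklore] -/
theorem lt_two_pow_guessLen (P : Polynomial ℕ) (n : ℕ) : P.eval n < 2 ^ guessLen P n := by
  have h := Nat.lt_pow_succ_log_self Nat.one_lt_two (P.eval n + 1)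
  unfold guessLen
  omega

/-- `2^{L(P,n)} ≤ 2 (P(n) + 1)`. [folklore] -/
theorem two_pow_guessLen_le (P : Polynomial ℕ) (n : ℕ) : 2 ^ guessLen P n ≤ 2 * (P.eval n + 1) := by
  rw [guessLen, pow_succ, mul_comm]
  exact Nat.mul_le_mul_left 2 (Nat.pow_log_le_self 2 (Nat.succ_ne_zero _))

/-- The ruler length `R(P, n) = 2 (P(n) + 1) ≥ 2^{L(P,n)}`. [folklore] -/
def rulerLen (P : Polynomial ℕ) (n : ℕ) : ℕ := 2 * (P.eval n + 1)

/-- `L(P, n) ≤ P(n) + 1`. [folklore] -/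
theorem guessLen_le (P : Polynomial ℕ) (n : ℕ) : guessLen P n ≤ P.eval n + 1 := by
  have h : Nat.log 2 (P.eval n + 1) < P.eval n + 1 := Nat.log_lt_self 2 (Nat.succ_ne_zero (P.eval n))
  unfold guessLen
  omega

variable (A : OracleAlg (List Bool)) (E : OracleAlg Bool) (qA : Polynomial ℕ)
variable (P₁ P₂ : Polynomial ℕ) (n : ℕ) (r : List Bool)

/-- The first guess block `g₁ = r ↾ L₁`. [folklore] -/
def g₁ : List Bool := r.take (guessLen P₁ n)
/-- The coins after `g₁`. [folklore] -/
def rest₁ : List Bool := r.drop (guessLen P₁ n)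
/-- The second guess block `g₂`. [folklore] -/
def g₂ : List Bool := (rest₁ P₁ n r).take (guessLen P₂ n)
/-- The coins after `g₂`: `ρ S`. [folklore] -/
def rest₂ : List Bool := (rest₁ P₁ n r).drop (guessLen P₂ n)
/-- The guessed coin budget `m' = ⟦g₁⟧` (capped by the ruler, inactive: `coinGuess_eq`). [folklore] -/
def coinGuess : ℕ := min (bitsToNat (g₁ P₁ n r)) (rulerLen P₁ n)
/-- The guessed evaluation budget `T₂' = ⟦g₂⟧` (capped by the ruler, inactive). [folklore] -/
def evalGuess : ℕ := min (bitsToNat (g₂ P₁ P₂ n r)) (rulerLen P₂ n)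
/-- The two test blocks `z₀ z₁` (the first `2n` coins after the guesses). [folklore] -/
def testBits : List Bool := (rest₂ P₁ P₂ n r).take (2 * n)
/-- The coins after the test blocks: `ρ S'` (`|ρ| = R₁(n)`). [folklore] -/
def afterTest : List Bool := (rest₂ P₁ P₂ n r).drop (2 * n)
/-- The learner's coins: the LAST `m'` bits of the block `ρ` (so that they are contiguous with the
samples `S'`, which eases the probabilistic analysis). [folklore] -/
def learnerCoins : List Bool :=
  ((afterTest P₁ P₂ n r).drop (rulerLen P₁ n - coinGuess P₁ n r)).take (coinGuess P₁ n r)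
/-- The learner's sample coins `S'` (everything after `ρ`). [folklore] -/
def samplesTail : List Bool := (afterTest P₁ P₂ n r).drop (rulerLen P₁ n)
/-- The sample string `S = z₀ z₁ S'` handed to the core algorithm: block `0`, `1` are the test points,
block `j + 2` is the learner's `j`-th example. [folklore] -/
def samples : List Bool := testBits P₁ P₂ n r ++ samplesTail P₁ P₂ n r
/-- Block `i` of `S`: `n` bits from position `i n`. [folklore] -/
def block (n : ℕ) (S : List Bool) (i : ℕ) : List Bool := (S.drop (i * n)).take n
/-- The learner's input `x_A = ⟨⟨1ⁿ, ⟨1⁸, 1⁸⟩⟩, ρ ↾ m'⟩` (`pacParams n 8 8`: accuracy and confidence `1/8`). [folklore] -/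
def learnerInput : List Bool := boolPair (pacParams n 8 8) (learnerCoins P₁ P₂ n r)
/-- The record `⟨x_A, ⟨1^{T₂'}, S⟩⟩` on which the core algorithm runs. [folklore] -/
def record : List Bool :=
  boolPair (learnerInput P₁ P₂ n r) (boolPair (unaryEncodeNat (evalGuess P₁ P₂ n r)) (samples P₁ P₂ n r))

/-- The cap on the coin guess is inactive. [folklore] -/
theorem coinGuess_eq : coinGuess P₁ n r = bitsToNat (g₁ P₁ n r) := by
  refine min_eq_left ?_
  have h1 := bitsToNat_lt (g₁ P₁ n r)
  have h2 : (g₁ P₁ n r).length ≤ guessLen P₁ n := by simp [g₁]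
  have h3 := Nat.pow_le_pow_right Nat.two_pos h2
  have h4 := two_pow_guessLen_le P₁ n
  rw [rulerLen]; omega

/-- The cap on the evaluation guess is inactive. [folklore] -/
theorem evalGuess_eq : evalGuess P₁ P₂ n r = bitsToNat (g₂ P₁ P₂ n r) := by
  refine min_eq_left ?_
  have h1 := bitsToNat_lt (g₂ P₁ P₂ n r)
  have h2 : (g₂ P₁ P₂ n r).length ≤ guessLen P₂ n := by simp [g₂]
  have h3 := Nat.pow_le_pow_right Nat.two_pos h2
  have h4 := two_pow_guessLen_le P₂ n
  rw [rulerLen]; omega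

/-- `m' < R₁(n)`. [folklore] -/
theorem coinGuess_lt : coinGuess P₁ n r < rulerLen P₁ n := by
  rw [coinGuess_eq]
  have h1 := bitsToNat_lt (g₁ P₁ n r)
  have h2 : (g₁ P₁ n r).length ≤ guessLen P₁ n := by simp [g₁]
  have h3 := Nat.pow_le_pow_right Nat.two_pos h2
  have h4 := two_pow_guessLen_le P₁ n
  rw [rulerLen]; omega

/-- A block has at most `n` bits. [folklore] -/
theorem length_block_le (n : ℕ) (S : List Bool) (i : ℕ) : (block n S i).length ≤ n := by
  simp [block]

/-- Length of the learner's input: `4n + 58 + m'`. [folklore] -/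
theorem length_learnerInput : (learnerInput P₁ P₂ n r).length = 4 * n + 58 + (learnerCoins P₁ P₂ n r).length := by
  simp [learnerInput, pacParams, length_boolPair, unaryEncodeNat_eq_replicate]
  ring

/-- The length bound `|x_A| ≤ 4n + 58 + R₁(n)`. [folklore] -/
theorem length_learnerInput_le : (learnerInput P₁ P₂ n r).length ≤ 4 * n + 58 + rulerLen P₁ n := by
  rw [length_learnerInput]
  have h1 : (learnerCoins P₁ P₂ n r).length ≤ coinGuess P₁ n r := by simp [learnerCoins]
  have h2 := coinGuess_lt P₁ n r
  omega

/-! ### The string bricks: input preparation `pre` -/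

section Bricks

open Complexity.Brick Complexity.Plumb Complexity.HashBricks

/-- `1^{L(P, n)}` computed from `z = ⟨1ⁿ, r⟩`. [folklore] -/
def lenF (P : Polynomial ℕ) : List Bool → List Bool := List.cons true ∘ logFn ∘ polyFn (P + 1) ∘ fstF

/-- The value of `lenF`. [folklore] -/
theorem lenF_apply (P : Polynomial ℕ) : lenF P (boolPair (unaryEncodeNat n) r) = List.replicate (guessLen P n) true := by
  simp [lenF, logFn, guessLen, ones, unaryEncodeNat_eq_replicate, List.replicate_succ]

/-- `lenF P ∈ FP`. [folklore] -/
theorem lenF_mem_FP (P : Polynomial ℕ) : lenF P ∈ FP :=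
  comp_mem_FP (cons_mem_FP true) (comp_mem_FP logFn_mem_FP (comp_mem_FP (polyFn_mem_FP _) fstF_mem_FP))

/-- `g₁` as a brick. [folklore] -/
def g1F : List Bool → List Bool := takeFn ∘ fanoutFn (lenF P₁) sndF
/-- `rest₁` as a brick. [folklore] -/
def rest1F : List Bool → List Bool := dropFn ∘ fanoutFn (lenF P₁) sndF
/-- `g₂` as a brick. [folklore] -/
def g2F : List Bool → List Bool := takeFn ∘ fanoutFn (lenF P₂) (rest1F P₁)
/-- `rest₂` as a brick. [folklore] -/
def rest2F : List Bool → List Bool := dropFn ∘ fanoutFn (lenF P₂) (rest1F P₁)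
/-- The ruler `1^{R(P, n)}`. [folklore] -/
def rulerF (P : Polynomial ℕ) : List Bool → List Bool := polyFn (2 * (P + 1)) ∘ fstF
/-- `1^{m'}`. [folklore] -/
def coinGuessF : List Bool → List Bool := binToUnaryFn ∘ fanoutFn (rulerF P₁) (g1F P₁)
/-- `1^{T₂'}`. [folklore] -/
def evalGuessF : List Bool → List Bool := binToUnaryFn ∘ fanoutFn (rulerF P₂) (g2F P₁ P₂)
/-- `1^{2n}`. [folklore] -/
def twoNF : List Bool → List Bool := polyFn (2 * X) ∘ fstF
/-- The test blocks as a brick. [folklore] -/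
def testBitsF : List Bool → List Bool := takeFn ∘ fanoutFn twoNF (rest2F P₁ P₂)
/-- `afterTest` as a brick. [folklore] -/
def afterTestF : List Bool → List Bool := dropFn ∘ fanoutFn twoNF (rest2F P₁ P₂)
/-- `1^{R₁ - m'}`. [folklore] -/
def skipF : List Bool → List Bool := dropFn ∘ fanoutFn (coinGuessF P₁) (rulerF P₁)
/-- The learner's coins as a brick. [folklore] -/
def learnerCoinsF : List Bool → List Bool :=
  takeFn ∘ fanoutFn (coinGuessF P₁) (dropFn ∘ fanoutFn (skipF P₁) (afterTestF P₁ P₂))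
/-- `samplesTail` as a brick. [folklore] -/
def samplesTailF : List Bool → List Bool := dropFn ∘ fanoutFn (rulerF P₁) (afterTestF P₁ P₂)
/-- The samples as a brick. [folklore] -/
def samplesF : List Bool → List Bool := fun z => testBitsF P₁ P₂ z ++ samplesTailF P₁ P₂ z
/-- `pacParams n 8 8` from `⟨1ⁿ, r⟩`. [folklore] -/
def paramsF : List Bool → List Bool := fanoutFn fstF (fun _ => boolPair (unaryEncodeNat 8) (unaryEncodeNat 8))
/-- The learner's input as a brick. [folklore] -/
def learnerInputF : List Bool → List Bool := fanoutFn paramsF (learnerCoinsF P₁ P₂)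
/-- **The input preparation** `pre`: `⟨1ⁿ, r⟩ ↦ ⟨x_A, ⟨1^{T₂'}, S⟩⟩`. [folklore] -/
def preF : List Bool → List Bool := fanoutFn (learnerInputF P₁ P₂) (fanoutFn (evalGuessF P₁ P₂) (samplesF P₁ P₂))

/-- The value of `g1F`. [folklore] -/
theorem g1F_apply : g1F P₁ (boolPair (unaryEncodeNat n) r) = g₁ P₁ n r := by
  simp [g1F, lenF_apply, g₁]
/-- The value of `rest1F`. [folklore] -/
theorem rest1F_apply : rest1F P₁ (boolPair (unaryEncodeNat n) r) = rest₁ P₁ n r := by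
  simp [rest1F, lenF_apply, rest₁]
/-- The value of `g2F`. [folklore] -/
theorem g2F_apply : g2F P₁ P₂ (boolPair (unaryEncodeNat n) r) = g₂ P₁ P₂ n r := by
  simp [g2F, lenF_apply, rest1F_apply, g₂]
/-- The value of `rest2F`. [folklore] -/
theorem rest2F_apply : rest2F P₁ P₂ (boolPair (unaryEncodeNat n) r) = rest₂ P₁ P₂ n r := by
  simp [rest2F, lenF_apply, rest1F_apply, rest₂]
/-- The value of `rulerF`. [folklore] -/
theorem rulerF_apply (P : Polynomial ℕ) : rulerF P (boolPair (unaryEncodeNat n) r) = List.replicate (rulerLen P n) true := by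
  simp [rulerF, rulerLen, ones, unaryEncodeNat_eq_replicate]
/-- The value of `coinGuessF`. [folklore] -/
theorem coinGuessF_apply : coinGuessF P₁ (boolPair (unaryEncodeNat n) r) = List.replicate (coinGuess P₁ n r) true := by
  simp [coinGuessF, rulerF_apply, g1F_apply, coinGuess, ones]
/-- The value of `evalGuessF`. [folklore] -/
theorem evalGuessF_apply : evalGuessF P₁ P₂ (boolPair (unaryEncodeNat n) r) = List.replicate (evalGuess P₁ P₂ n r) true := by
  simp [evalGuessF, rulerF_apply, g2F_apply, evalGuess, ones]
/-- The value of `twoNF`. [folklore] -/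
theorem twoNF_apply : twoNF (boolPair (unaryEncodeNat n) r) = List.replicate (2 * n) true := by
  simp [twoNF, ones, unaryEncodeNat_eq_replicate]
/-- The value of `testBitsF`. [folklore] -/
theorem testBitsF_apply : testBitsF P₁ P₂ (boolPair (unaryEncodeNat n) r) = testBits P₁ P₂ n r := by
  simp [testBitsF, twoNF_apply, rest2F_apply, testBits]
/-- The value of `afterTestF`. [folklore] -/
theorem afterTestF_apply : afterTestF P₁ P₂ (boolPair (unaryEncodeNat n) r) = afterTest P₁ P₂ n r := by
  simp [afterTestF, twoNF_apply, rest2F_apply, afterTest]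
/-- The value of `skipF`. [folklore] -/
theorem skipF_apply : skipF P₁ (boolPair (unaryEncodeNat n) r) = List.replicate (rulerLen P₁ n - coinGuess P₁ n r) true := by
  simp [skipF, coinGuessF_apply, rulerF_apply, List.drop_replicate]
/-- The value of `learnerCoinsF`. [folklore] -/
theorem learnerCoinsF_apply : learnerCoinsF P₁ P₂ (boolPair (unaryEncodeNat n) r) = learnerCoins P₁ P₂ n r := by
  simp [learnerCoinsF, coinGuessF_apply, skipF_apply, afterTestF_apply, learnerCoins]
/-- The value of `samplesTailF`. [folklore] -/
theorem samplesTailF_apply : samplesTailF P₁ P₂ (boolPair (unaryEncodeNat n) r) = samplesTail P₁ P₂ n r := by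
  simp [samplesTailF, rulerF_apply, afterTestF_apply, samplesTail]
/-- The value of `samplesF`. [folklore] -/
theorem samplesF_apply : samplesF P₁ P₂ (boolPair (unaryEncodeNat n) r) = samples P₁ P₂ n r := by
  simp only [samplesF, testBitsF_apply, samplesTailF_apply, samples]
/-- The value of `learnerInputF`. [folklore] -/
theorem learnerInputF_apply : learnerInputF P₁ P₂ (boolPair (unaryEncodeNat n) r) = learnerInput P₁ P₂ n r := by
  simp [learnerInputF, paramsF, learnerCoinsF_apply, learnerInput, pacParams]
/-- **The value of `preF`**: the record. [folklore] -/
theorem preF_apply : preF P₁ P₂ (boolPair (unaryEncodeNat n) r) = record P₁ P₂ n r := by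
  rw [preF, fanoutFn_apply, fanoutFn_apply, learnerInputF_apply, evalGuessF_apply, samplesF_apply, record,
    unaryEncodeNat_eq_replicate (evalGuess P₁ P₂ n r)]

/-- `rulerF P ∈ FP`. [folklore] -/
theorem rulerF_mem_FP (P : Polynomial ℕ) : rulerF P ∈ FP := comp_mem_FP (polyFn_mem_FP _) fstF_mem_FP
/-- `g1F ∈ FP`. [folklore] -/
theorem g1F_mem_FP : g1F P₁ ∈ FP := comp_mem_FP takeFn_mem_FP (fanoutFn_mem_FP (lenF_mem_FP _) sndF_mem_FP)
/-- `rest1F ∈ FP`. [folklore] -/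
theorem rest1F_mem_FP : rest1F P₁ ∈ FP := comp_mem_FP dropFn_mem_FP (fanoutFn_mem_FP (lenF_mem_FP _) sndF_mem_FP)
/-- `g2F ∈ FP`. [folklore] -/
theorem g2F_mem_FP : g2F P₁ P₂ ∈ FP := comp_mem_FP takeFn_mem_FP (fanoutFn_mem_FP (lenF_mem_FP _) (rest1F_mem_FP _))
/-- `rest2F ∈ FP`. [folklore] -/
theorem rest2F_mem_FP : rest2F P₁ P₂ ∈ FP := comp_mem_FP dropFn_mem_FP (fanoutFn_mem_FP (lenF_mem_FP _) (rest1F_mem_FP _))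
/-- `coinGuessF ∈ FP`. [folklore] -/
theorem coinGuessF_mem_FP : coinGuessF P₁ ∈ FP :=
  comp_mem_FP binToUnaryFn_mem_FP (fanoutFn_mem_FP (rulerF_mem_FP _) (g1F_mem_FP _))
/-- `evalGuessF ∈ FP`. [folklore] -/
theorem evalGuessF_mem_FP : evalGuessF P₁ P₂ ∈ FP :=
  comp_mem_FP binToUnaryFn_mem_FP (fanoutFn_mem_FP (rulerF_mem_FP _) (g2F_mem_FP _ _))
/-- `twoNF ∈ FP`. [folklore] -/
theorem twoNF_mem_FP : twoNF ∈ FP := comp_mem_FP (polyFn_mem_FP _) fstF_mem_FP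
/-- `testBitsF ∈ FP`. [folklore] -/
theorem testBitsF_mem_FP : testBitsF P₁ P₂ ∈ FP :=
  comp_mem_FP takeFn_mem_FP (fanoutFn_mem_FP twoNF_mem_FP (rest2F_mem_FP _ _))
/-- `afterTestF ∈ FP`. [folklore] -/
theorem afterTestF_mem_FP : afterTestF P₁ P₂ ∈ FP :=
  comp_mem_FP dropFn_mem_FP (fanoutFn_mem_FP twoNF_mem_FP (rest2F_mem_FP _ _))
/-- `skipF ∈ FP`. [folklore] -/
theorem skipF_mem_FP : skipF P₁ ∈ FP :=
  comp_mem_FP dropFn_mem_FP (fanoutFn_mem_FP (coinGuessF_mem_FP _) (rulerF_mem_FP _))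
/-- `learnerCoinsF ∈ FP`. [folklore] -/
theorem learnerCoinsF_mem_FP : learnerCoinsF P₁ P₂ ∈ FP :=
  comp_mem_FP takeFn_mem_FP (fanoutFn_mem_FP (coinGuessF_mem_FP _)
    (comp_mem_FP dropFn_mem_FP (fanoutFn_mem_FP (skipF_mem_FP _) (afterTestF_mem_FP _ _))))
/-- `samplesTailF ∈ FP`. [folklore] -/
theorem samplesTailF_mem_FP : samplesTailF P₁ P₂ ∈ FP :=
  comp_mem_FP dropFn_mem_FP (fanoutFn_mem_FP (rulerF_mem_FP _) (afterTestF_mem_FP _ _))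
/-- `samplesF ∈ FP`. [folklore] -/
theorem samplesF_mem_FP : samplesF P₁ P₂ ∈ FP := append_mem_FP (testBitsF_mem_FP _ _) (samplesTailF_mem_FP _ _)
/-- `paramsF ∈ FP`. [folklore] -/
theorem paramsF_mem_FP : paramsF ∈ FP := fanoutFn_mem_FP fstF_mem_FP (const_mem_FP _)
/-- `learnerInputF ∈ FP`. [folklore] -/
theorem learnerInputF_mem_FP : learnerInputF P₁ P₂ ∈ FP := fanoutFn_mem_FP paramsF_mem_FP (learnerCoinsF_mem_FP _ _)
/-- **`preF ∈ FP`.** [Arora–Barak 2009, §1.3] [folklore] -/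
theorem preF_mem_FP : preF P₁ P₂ ∈ FP :=
  fanoutFn_mem_FP (learnerInputF_mem_FP _ _) (fanoutFn_mem_FP (evalGuessF_mem_FP _ _) (samplesF_mem_FP _ _))

/-! ### The string bricks: query rewriting `d` -/

/-- `1ⁿ` read off a record `⟨⟨x_A, …⟩, …⟩` (`x_A = ⟨⟨1ⁿ, …⟩, …⟩`). [folklore] -/
def dnF : List Bool → List Bool := fstF ∘ fstF ∘ fstF ∘ fstF
/-- `S` read off `⟨⟨x_A, ⟨1^{T₂'}, S⟩⟩, …⟩`. [folklore] -/
def dSF : List Bool → List Bool := sndF ∘ sndF ∘ fstF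
/-- `1^{|as|}` read off `⟨xp, ⟨listBool as, q⟩⟩`. [folklore] -/
def diF : List Bool → List Bool := fstF ∘ fstF ∘ sndF
/-- `q` read off `⟨xp, ⟨listBool as, q⟩⟩`. [folklore] -/
def dqF : List Bool → List Bool := sndF ∘ sndF
/-- The membership-query test `[q = 1y ∧ |y| = n]`. [folklore] -/
def isMQF : List Bool → List Bool :=
  andFn (headBitFn ∘ dqF) (eqPairFn ∘ fanoutFn (onesFn ∘ PRelSigma.tailT.eval ∘ dqF) dnF)
/-- Block `|as|` of `S`. [folklore] -/
def blockF : List Bool → List Bool :=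
  takeFn ∘ fanoutFn dnF (dropFn ∘ fanoutFn (umulFn ∘ fanoutFn diF dnF) dSF)
/-- **The query rewriting** `d`: keep a membership query, replace anything else by `0 · block_{|as|}`. [folklore] -/
def dF : List Bool → List Bool := iteFn isMQF dqF (List.cons false ∘ blockF)

/-- The membership-query test of `pacOracle true` on strings: `q = 1y` with `|y| = n`. [folklore] -/
def isMQ (n : ℕ) (q : List Bool) : Bool := q.headD false && decide (q.tail.length = n)

/-- The rewritten query at round `i`: `q` itself if it is a membership query, else the example request
`0 · block i`. [folklore] -/
def dMath (n : ℕ) (S : List Bool) (i : ℕ) (q : List Bool) : List Bool :=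
  if isMQ n q then q else false :: block n S i

/-- `dnF` on a `d`-input over the record. [folklore] -/
theorem dnF_apply (y : List Bool) : dnF (boolPair (record P₁ P₂ n r) y) = unaryEncodeNat n := by
  simp only [dnF, record, learnerInput, pacParams, Function.comp_apply, fstF_boolPair]

/-- `dSF` on a `d`-input over the record. [folklore] -/
theorem dSF_apply (y : List Bool) : dSF (boolPair (record P₁ P₂ n r) y) = samples P₁ P₂ n r := by
  simp only [dSF, record, Function.comp_apply, fstF_boolPair, sndF_boolPair]

/-- `diF` on a `d`-input. [folklore] -/
theorem diF_apply (xp : List Bool) (as : List (List Bool)) (q : List Bool) :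
    diF (boolPair xp (boolPair ((encodingList Bool).listBool.encode as) q)) = unaryEncodeNat as.length := by
  simp only [diF, OracleAlg.PrefixPostPoly.listBool_encode_eq, Function.comp_apply, fstF_boolPair, sndF_boolPair]

/-- `dqF` on a `d`-input. [folklore] -/
theorem dqF_apply (xp : List Bool) (as : List (List Bool)) (q : List Bool) :
    dqF (boolPair xp (boolPair ((encodingList Bool).listBool.encode as) q)) = q := by
  simp only [dqF, Function.comp_apply, sndF_boolPair]

/-- The length of a unary numeral (`= unary_decode_encode_nat`, `unaryDecodeNat` being `List.length`; the tree
holds many private copies of this bridge and public twins outside this file's import cone, e.g.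
`Cryptography.length_unaryEncodeNat` in `ImpagliazzoLevinOWF.lean`). [folklore] -/
theorem length_unaryEncodeNat (k : ℕ) : (unaryEncodeNat k).length = k := by
  rw [unaryEncodeNat_eq_replicate, List.length_replicate]

/-- Unary numerals are equal iff their values are. [folklore] -/
theorem decide_unaryEncodeNat_eq (a b : ℕ) : decide (unaryEncodeNat a = unaryEncodeNat b) = decide (a = b) :=
  Bool.decide_congr ⟨fun h => by simpa only [length_unaryEncodeNat] using congrArg List.length h, fun h => by rw [h]⟩

/-- The value of `dF` from the values of the accessors. [folklore] -/
theorem dF_apply_of {v : List Bool} {n : ℕ} {S : List Bool} {i : ℕ} {q : List Bool}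
    (hn : dnF v = unaryEncodeNat n) (hS : dSF v = S) (hi : diF v = unaryEncodeNat i) (hq : dqF v = q) :
    dF v = dMath n S i q := by
  have hc : isMQF v = [isMQ n q] := by
    unfold isMQF isMQ
    refine andFn_apply (by rw [Function.comp_apply, hq, headBitFn_apply]) ?_
    rw [Function.comp_apply, fanoutFn_apply, eqPairFn_boolPair, hn]
    simp only [Function.comp_apply, hq, PRelSigma.tailT_eval, onesFn]
    rw [decide_unaryEncodeNat_eq]
  have hb : blockF v = block n S i := by
    simp only [blockF, Function.comp_apply, fanoutFn_apply]
    rw [hn, hi, hS, umulFn_apply, fstF_boolPair, sndF_boolPair, length_unaryEncodeNat, length_unaryEncodeNat,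
      dropFn_boolPair, takeFn_boolPair, length_unaryEncodeNat, List.length_replicate, block]
  unfold dF dMath
  cases hm : isMQ n q
  · rw [iteFn_apply_false (by rw [hc, hm]), Function.comp_apply, hb, if_neg Bool.false_ne_true]
  · rw [iteFn_apply_true (by rw [hc, hm]), hq, if_pos rfl]

/-- **The value of `dF`.** [folklore] -/
theorem dF_apply (as : List (List Bool)) (q : List Bool) :
    dF (boolPair (record P₁ P₂ n r) (boolPair ((encodingList Bool).listBool.encode as) q)) =
      dMath n (samples P₁ P₂ n r) as.length q :=
  dF_apply_of (dnF_apply P₁ P₂ n r _) (dSF_apply P₁ P₂ n r _) (diF_apply _ as q) (dqF_apply _ as q)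

/-- `dF ∈ FP`. [Arora–Barak 2009, §1.3] [folklore] -/
theorem dF_mem_FP : dF ∈ FP := by
  have hn : dnF ∈ FP := comp_mem_FP fstF_mem_FP (comp_mem_FP fstF_mem_FP (comp_mem_FP fstF_mem_FP fstF_mem_FP))
  have hS : dSF ∈ FP := comp_mem_FP sndF_mem_FP (comp_mem_FP sndF_mem_FP fstF_mem_FP)
  have hi : diF ∈ FP := comp_mem_FP fstF_mem_FP (comp_mem_FP fstF_mem_FP sndF_mem_FP)
  have hq : dqF ∈ FP := comp_mem_FP sndF_mem_FP sndF_mem_FP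
  have hc : isMQF ∈ FP := andFn_mem_FP (comp_mem_FP headBitFn_mem_FP hq)
    (comp_mem_FP eqPairFn_mem_FP (fanoutFn_mem_FP
      (comp_mem_FP onesFn_mem_FP (comp_mem_FP PRelSigma.tailT.polyTimeComputable_eval hq)) hn))
  have hb : blockF ∈ FP := comp_mem_FP takeFn_mem_FP (fanoutFn_mem_FP hn (comp_mem_FP dropFn_mem_FP
    (fanoutFn_mem_FP (comp_mem_FP umulFn_mem_FP (fanoutFn_mem_FP hi hn)) hS)))
  exact iteFn_mem_FP hc hq (comp_mem_FP (cons_mem_FP false) hb)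

/-- Rewritten queries are short: `|dMath n S i q| ≤ n + 1`. [folklore] -/
theorem length_dMath_le (n : ℕ) (S : List Bool) (i : ℕ) (q : List Bool) : (dMath n S i q).length ≤ n + 1 := by
  unfold dMath
  split_ifs with h
  · simp only [isMQ, Bool.and_eq_true, decide_eq_true_eq] at h
    cases q with
    | nil => simp
    | cons b q => simp at h; simp [h.2]
  · simpa using length_block_le n S i

/-! ### The string bricks: the verdict `h` -/

/-- `1^{T₂'}` read off `⟨⟨x_A, ⟨1^{T₂'}, S⟩⟩, …⟩`. [folklore] -/
def hTF : List Bool → List Bool := fstF ∘ sndF ∘ fstF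
/-- `w` read off `⟨xp, ⟨listBool as, w⟩⟩`. [folklore] -/
def hwF : List Bool → List Bool := sndF ∘ sndF
/-- The body of `listBool as` read off `⟨xp, ⟨listBool as, w⟩⟩`. [folklore] -/
def hbodyF : List Bool → List Bool := sndF ∘ fstF ∘ sndF
/-- Answer `0` (the first test example). [folklore] -/
def a0F : List Bool → List Bool := fstF ∘ hbodyF
/-- Answer `1` (the second test example). [folklore] -/
def a1F : List Bool → List Bool := fstF ∘ sndF ∘ hbodyF
/-- The point `a ↾ n` of a labelled example `a`. [folklore] -/
def zOf (a : List Bool → List Bool) : List Bool → List Bool := takeFn ∘ fanoutFn dnF a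
/-- The label bit `[a[n]]` of a labelled example `a`. [folklore] -/
def lOf (a : List Bool → List Bool) : List Bool → List Bool := headBitFn ∘ dropFn ∘ fanoutFn dnF a
/-- The evaluation record `⟨1^{T₂'}, ⟨w, z⟩⟩`. [folklore] -/
def recOf (a : List Bool → List Bool) : List Bool → List Bool := fanoutFn hTF (fanoutFn hwF (zOf a))
/-- The prediction bit `[h(z)]`, `h = evalHyp E T₂' w`: the indicator of `runEmptyLang E`. [folklore] -/
def pOf (E : OracleAlg Bool) (a : List Bool → List Bool) : List Bool → List Bool :=
  (fun u => encodeBool ((runEmptyLang E).boolIndicator u)) ∘ recOf a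
/-- The agreement bit `[h(z) = label]`. [folklore] -/
def eOf (E : OracleAlg Bool) (a : List Bool → List Bool) : List Bool → List Bool := notFn (xorFn (pOf E a) (lOf a))
/-- **The verdict** `h`: `[(h(z₀) = ℓ₀) ↔ (h(z₁) = ℓ₁)]`. [folklore] -/
def hF (E : OracleAlg Bool) : List Bool → List Bool := notFn (xorFn (eOf E a0F) (eOf E a1F))

/-- The prediction of the hypothesis `evalHyp E T w` at the string point `z`. [folklore] -/
def predBit (E : OracleAlg Bool) (T : ℕ) (w z : List Bool) : Bool := (E.run (fun _ => []) T (boolPair w z)).getD false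

/-- The agreement bit on a labelled example `a = z · ℓ` (`z = a ↾ n`, `ℓ = a[n]`). [folklore] -/
def agreeBit (E : OracleAlg Bool) (T n : ℕ) (w a : List Bool) : Bool :=
  predBit E T w (a.take n) == (a.drop n).headD false

/-- The verdict bit computed from the two labelled test examples. [folklore] -/
def verdictOf (E : OracleAlg Bool) (T n : ℕ) (w a₀ a₁ : List Bool) : Bool :=
  agreeBit E T n w a₀ == agreeBit E T n w a₁

/-- `!(b xor b') = (b == b')`. [folklore] -/
theorem not_xor_eq_beq (b b' : Bool) : (!xor b b') = (b == b') := by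
  cases b <;> cases b' <;> rfl

/-- **The value of `hF`.** [folklore] -/
theorem hF_apply (E : OracleAlg Bool) (a₀ a₁ : List Bool) (rest : List (List Bool)) (w : List Bool) :
    hF E (boolPair (record P₁ P₂ n r) (boolPair ((encodingList Bool).listBool.encode (a₀ :: a₁ :: rest)) w)) =
      [verdictOf E (evalGuess P₁ P₂ n r) n w a₀ a₁] := by
  set c := boolPair (record P₁ P₂ n r) (boolPair ((encodingList Bool).listBool.encode (a₀ :: a₁ :: rest)) w) with hc
  have hn : dnF c = unaryEncodeNat n := dnF_apply P₁ P₂ n r _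
  have hT : hTF c = unaryEncodeNat (evalGuess P₁ P₂ n r) := by simp [hc, hTF, record]
  have hw : hwF c = w := by simp [hc, hwF]
  have h0 : a0F c = a₀ := by simp [hc, a0F, hbodyF, OracleAlg.PrefixPostPoly.listBool_encode_eq]
  have h1 : a1F c = a₁ := by simp [hc, a1F, hbodyF, OracleAlg.PrefixPostPoly.listBool_encode_eq]
  have hlen : (unaryEncodeNat n).length = n := by simp [unaryEncodeNat_eq_replicate]
  have he : ∀ (aF : List Bool → List Bool) (a : List Bool), aF c = a →
      eOf E aF c = [agreeBit E (evalGuess P₁ P₂ n r) n w a] := by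
    intro aF a ha
    have hz : zOf aF c = a.take n := by
      rw [zOf, Function.comp_apply, fanoutFn_apply, hn, ha, takeFn_boolPair, hlen]
    have hl : lOf aF c = [(a.drop n).headD false] := by
      rw [lOf, Function.comp_apply, Function.comp_apply, fanoutFn_apply, hn, ha, dropFn_boolPair, hlen, headBitFn_apply]
    have hp : pOf E aF c = [predBit E (evalGuess P₁ P₂ n r) w (a.take n)] := by
      rw [pOf, Function.comp_apply, recOf, fanoutFn_apply, fanoutFn_apply, hT, hw, hz, boolIndicator_runEmptyLang,
        fstF_boolPair, sndF_boolPair, length_unaryEncodeNat]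
      rfl
    rw [eOf, notFn_apply (xorFn_apply hp hl), not_xor_eq_beq]
    rfl
  rw [hF, notFn_apply (xorFn_apply (he a0F a₀ h0) (he a1F a₁ h1)), not_xor_eq_beq]
  rfl

/-- `hF E ∈ FP` for polynomial-time `E` (`runEmptyLang_mem_P`). [Arora–Barak 2009, §1.3] [folklore] -/
theorem hF_mem_FP {E : OracleAlg Bool} (hE : E.IsPolyTime encodingBoolBool) : hF E ∈ FP := by
  have hn : dnF ∈ FP := comp_mem_FP fstF_mem_FP (comp_mem_FP fstF_mem_FP (comp_mem_FP fstF_mem_FP fstF_mem_FP))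
  have hT : hTF ∈ FP := comp_mem_FP fstF_mem_FP (comp_mem_FP sndF_mem_FP fstF_mem_FP)
  have hw : hwF ∈ FP := comp_mem_FP sndF_mem_FP sndF_mem_FP
  have hb : hbodyF ∈ FP := comp_mem_FP sndF_mem_FP (comp_mem_FP fstF_mem_FP sndF_mem_FP)
  have h0 : a0F ∈ FP := comp_mem_FP fstF_mem_FP hb
  have h1 : a1F ∈ FP := comp_mem_FP fstF_mem_FP (comp_mem_FP sndF_mem_FP hb)
  have he : ∀ {aF : List Bool → List Bool}, aF ∈ FP → eOf E aF ∈ FP := fun {aF} ha =>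
    notFn_mem_FP (xorFn_mem_FP
      (comp_mem_FP (indicatorFn_mem_FP (runEmptyLang_mem_P hE))
        (fanoutFn_mem_FP hT (fanoutFn_mem_FP hw (comp_mem_FP takeFn_mem_FP (fanoutFn_mem_FP hn ha)))))
      (comp_mem_FP headBitFn_mem_FP (comp_mem_FP dropFn_mem_FP (fanoutFn_mem_FP hn ha))))
  exact notFn_mem_FP (xorFn_mem_FP (he h0) (he h1))

/-! ### The inner algorithm: intermediate queries to `𝒪`-queries -/

/-- The query generator: `⟨u, 1ⁱ⟩ ↦ u.tail`. [folklore] -/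
def midQ : List Bool → List Bool := PRelSigma.tailT.eval ∘ fstF
/-- The output map: `⟨u, v⟩ ↦ v ↾ 1` for a membership query `u = 1y`, `u.tail · (v ↾ 1)` otherwise. [folklore] -/
def midG : List Bool → List Bool :=
  iteFn (headBitFn ∘ fstF) (take1Fn ∘ sndF) (fun z => (PRelSigma.tailT.eval ∘ fstF) z ++ (take1Fn ∘ sndF) z)
/-- **The inner algorithm** `N`: ask `𝒪` the point of the intermediate query, return the first answer bit
(membership query) or the labelled example. [Kearns–Valiant 1994, §3] [folklore] -/
def midAlg : OracleAlg (List Bool) := ttFnAlg midQ 1 midG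

/-- The intermediate oracle computed by `midAlg` from `𝒪`: `1y ↦ 𝒪(y) ↾ 1`, `0p ↦ p · (𝒪(p) ↾ 1)`. [folklore] -/
def fMid (𝒪 : Oracle) (u : List Bool) : List Bool :=
  if u.headD false then (𝒪 u.tail).take 1 else u.tail ++ (𝒪 u.tail).take 1

/-- The value of `midG`. [folklore] -/
theorem midG_apply (u v : List Bool) :
    midG (boolPair u v) = if u.headD false then v.take 1 else u.tail ++ v.take 1 := by
  unfold midG
  have hc : (headBitFn ∘ fstF) (boolPair u v) = [u.headD false] := by simp
  cases hu : u.headD false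
  · rw [iteFn_apply_false (by rw [hc, hu])]
    simp [take1Fn, PRelSigma.tailT_eval]
  · rw [iteFn_apply_true (by rw [hc, hu])]
    simp [take1Fn]

/-- **`midAlg` computes `fMid 𝒪`** within two rounds (one query). [folklore] -/
theorem run_midAlg (𝒪 : Oracle) (u : List Bool) {k : ℕ} (hk : 2 ≤ k) : midAlg.run 𝒪 k u = some (fMid 𝒪 u) := by
  obtain ⟨k, rfl⟩ := Nat.exists_eq_add_of_le hk
  rw [show 2 + k = (k + 1) + 1 by omega]
  change (ttFnAlg midQ 1 midG).runAux 𝒪 u (k + 1 + 1) [] = _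
  rw [runAux_succ, ttFnAlg_step_of_lt u (by simp)]
  dsimp only
  rw [runAux_succ, ttFnAlg_step_of_le u (by simp)]
  simp [midQ, midG_apply, fMid, PRelSigma.tailT_eval]

/-- **The queries of `midAlg`**: the single point `u.tail`. [folklore] -/
theorem queries_midAlg (𝒪 : Oracle) (u : List Bool) {k : ℕ} (hk : 2 ≤ k) : midAlg.queries 𝒪 k u = [u.tail] := by
  obtain ⟨k, rfl⟩ := Nat.exists_eq_add_of_le hk
  rw [show 2 + k = (k + 1) + 1 by omega]
  change midAlg.queriesAux 𝒪 u (k + 1 + 1) [] = _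
  unfold queriesAux
  rw [midAlg, ttFnAlg_step_of_lt u (by simp)]
  dsimp only
  unfold queriesAux
  rw [ttFnAlg_step_of_le u (by simp)]
  simp [midQ, PRelSigma.tailT_eval]

/-- `midAlg` is polynomial-time. [Ladner–Lynch–Selman 1975, §3] [folklore] -/
theorem isPolyTime_midAlg : midAlg.IsPolyTime (encodingList Bool) :=
  isPolyTime_ttFnAlg (comp_mem_FP PRelSigma.tailT.polyTimeComputable_eval fstF_mem_FP)
    (iteFn_mem_FP (comp_mem_FP headBitFn_mem_FP fstF_mem_FP) (comp_mem_FP take1Fn_mem_FP sndF_mem_FP)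
      (append_mem_FP (comp_mem_FP PRelSigma.tailT.polyTimeComputable_eval fstF_mem_FP)
        (comp_mem_FP take1Fn_mem_FP sndF_mem_FP)))

/-- Intermediate answers are short: `|fMid 𝒪 u| ≤ |u| + 1`. [folklore] -/
theorem length_fMid_le (𝒪 : Oracle) (u : List Bool) : (fMid 𝒪 u).length ≤ u.length + 1 := by
  unfold fMid
  have h1 : ((𝒪 u.tail).take 1).length ≤ 1 := by simp
  split_ifs
  · exact h1.trans (by omega)
  · rw [List.length_append]
    have h2 : u.tail.length = u.length - 1 := List.length_tail
    omega

end Bricks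

/-! ### The adversary -/

section Adversary

open Complexity.Brick Cryptography

/-- **The core algorithm** in the intermediate-oracle world: two example requests, then the clocked
learner on `x_A` (read off the record) with its queries rewritten by `d`, then the verdict `h`.
[Kearns–Valiant 1994, §3; Oliveira–Santhanam 2017, §4 Prop. 1] [folklore] -/
def learnerCore : OracleAlg Bool :=
  ((((A.clock qA []).comap fstF).prefixShift 2).postOut (hF E)).mapQuery dF

/-- The resource polynomial handed to `OracleComposition.compose`. [folklore] -/
def composeP (qA : Polynomial ℕ) : Polynomial ℕ := 3 * qA + X + 8

/-- **The composite algorithm**: `learnerCore` with each intermediate query answered by `midAlg`.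
[Ladner–Lynch–Selman 1975, §2; Arora–Barak 2009, §3.4] [folklore] -/
def distCore : OracleAlg Bool :=
  OracleComposition.compose (learnerCore A E qA) midAlg encodingBoolBool (OracleComposition.prmOf (composeP qA))

/-- The polynomial `4X + 60 + 2(P₁ + 1)` bounding `|x_A|`. [folklore] -/
def inputBoundPoly : Polynomial ℕ := 4 * X + 60 + 2 * (P₁ + 1)

/-- The round budget of the adversary: `qA(4n + 60 + 2(P₁(n)+1)) + 3`. [folklore] -/
def fuelPoly : Polynomial ℕ := qA.comp (inputBoundPoly P₁) + 3

/-- The coin budget of the adversary: guesses, `2n` test bits, the block `ρ`, and `(fuel + 2) n` sample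
bits. [folklore] -/
def coinsPoly : Polynomial ℕ := (P₁ + 1) + (P₂ + 1) + 2 * X + 2 * (P₁ + 1) + (fuelPoly qA P₁ + 2) * X

/-- **The distinguisher**: the composite algorithm reading the record prepared by `pre`, with its coin
and round budgets. [GGM 1986, §3; Kearns–Valiant 1994, §3; Oliveira–Santhanam 2017, §4 Prop. 1] [folklore] -/
def distinguisher : OracleAdversary Bool where
  alg := (distCore A E qA).comap (preF P₁ P₂)
  coins := coinsPoly qA P₁ P₂
  fuel := fuelPoly qA P₁

variable {A E}

/-- `learnerCore` is polynomial-time. [Arora–Barak 2009, §3.4 with §1.3] [folklore] -/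
theorem isPolyTime_learnerCore (hA : A.IsPolyTime (encodingList Bool)) (hE : E.IsPolyTime encodingBoolBool) :
    (learnerCore A E qA).IsPolyTime encodingBoolBool :=
  isPolyTime_mapQuery _ (isPolyTime_postOut (isPolyTime_prefixShift _ (isPolyTime_comap _
    (isPolyTime_clock _ hA qA []) fstF_mem_FP) 2) (hF_mem_FP hE)) dF_mem_FP

/-- `distCore` is polynomial-time. [Arora–Barak 2009, §3.4 with Claim 1.6] [folklore] -/
theorem isPolyTime_distCore (hA : A.IsPolyTime (encodingList Bool)) (hE : E.IsPolyTime encodingBoolBool) :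
    (distCore A E qA).IsPolyTime encodingBoolBool :=
  OracleComposition.isPolyTime_compose (isPolyTime_learnerCore qA hA hE) isPolyTime_midAlg _

/-- **The distinguisher is probabilistic polynomial-time.** [GGM 1986, §3; Arora–Barak 2009, §3.4] [folklore] -/
theorem isPPT_distinguisher (hA : A.IsPolyTime (encodingList Bool)) (hE : E.IsPolyTime encodingBoolBool) :
    (distinguisher A E qA P₁ P₂).IsPPT encodingBoolBool :=
  isPolyTime_comap _ (isPolyTime_distCore qA hA hE) (preF_mem_FP P₁ P₂)

/-! ### The deterministic run -/

variable (A E)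

/-- The indexed oracle seen by the clocked learner: membership queries answered by the first bit of
`𝒪`, the `j`-th other query by the labelled example on block `j + 2` of `S`. [Kearns–Vazirani 1994,
§1.2 and §8.1 (`EX`, `MQ`)] [folklore] -/
def learnOracle (𝒪 : Oracle) (n : ℕ) (S : List Bool) : ℕ → List Bool → List Bool :=
  fun j q => fMid 𝒪 (dMath n S (j + 2) q)

/-- The learner's output within `qA(|x_A|)` rounds (`ε` if none). [folklore] -/
def learnOut (𝒪 : Oracle) (n : ℕ) (xA S : List Bool) : List Bool :=
  (A.runIdx (learnOracle 𝒪 n S) (qA.eval xA.length) xA).getD []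

/-- The `i`-th labelled example `block i · 𝒪(block i)₀`. [folklore] -/
def exampleAns (𝒪 : Oracle) (n : ℕ) (S : List Bool) (i : ℕ) : List Bool := block n S i ++ (𝒪 (block n S i)).take 1

/-- **The verdict** of the distinguisher on `1ⁿ` with coins `r` against `𝒪`. [folklore] -/
def verdict (𝒪 : Oracle) : Bool :=
  verdictOf E (evalGuess P₁ P₂ n r) n
    (learnOut A qA 𝒪 n (learnerInput P₁ P₂ n r) (samples P₁ P₂ n r))
    (exampleAns 𝒪 n (samples P₁ P₂ n r) 0) (exampleAns 𝒪 n (samples P₁ P₂ n r) 1)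

/-- A blank query at round `i` requests example `i`. [folklore] -/
theorem fMid_dMath_nil (𝒪 : Oracle) (S : List Bool) (i : ℕ) : fMid 𝒪 (dMath n S i []) = exampleAns 𝒪 n S i := by
  simp [fMid, dMath, isMQ, exampleAns]

/-- **The run of `learnerCore`** against the intermediate oracle `fMid 𝒪` on the record: the verdict.
[Kearns–Valiant 1994, §3; Oliveira–Santhanam 2017, §4 Prop. 1] [folklore] -/
theorem run_learnerCore (𝒪 : Oracle) {K : ℕ} (hK : qA.eval (learnerInput P₁ P₂ n r).length + 3 ≤ K) :
    (learnerCore A E qA).run (fMid 𝒪) K (record P₁ P₂ n r) = some (verdict A E qA P₁ P₂ n r 𝒪) := by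
  obtain ⟨K, rfl⟩ : ∃ K', K = K' + 1 + 1 := ⟨K - 2, by omega⟩
  have hfst : fstF (record P₁ P₂ n r) = learnerInput P₁ P₂ n r := by
    simp only [record, fstF_boolPair]
  rw [learnerCore, OracleAlg.run,
    runAux_mapQuery_of_index _ dF (dMath n (samples P₁ P₂ n r)) (fMid 𝒪) (record P₁ P₂ n r) (dF_apply P₁ P₂ n r),
    runIdxAux_eq_map_runIdxT, runIdxT_postOut, runIdxT_prefixShift_of_lt _ 2 _ _ _ (by simp),
    runIdxT_prefixShift_of_lt _ 2 _ _ _ (by simp), runIdxT_prefixShift_of_le _ 2 _ _ _ _ (by simp),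
    runIdxT_comap, hfst, clock_eq_clockBy]
  obtain ⟨asF, hF⟩ := exists_runIdxT_clockBy A (fun w => qA.eval w.length) []
    (fun i => (fun i q => fMid 𝒪 (dMath n (samples P₁ P₂ n r) i q)) (i + 2)) (learnerInput P₁ P₂ n r) K []
    (by simp) (by simp; omega)
  simp only [List.nil_append, List.length_singleton, List.length_nil] at hF ⊢
  rw [show ([fMid 𝒪 (dMath n (samples P₁ P₂ n r) 0 [])] ++ [fMid 𝒪 (dMath n (samples P₁ P₂ n r) 1 [])]).drop 2 = []
    by rfl, hF]
  simp only [Option.map_some, Nat.sub_zero, List.cons_append, List.nil_append, fMid_dMath_nil, List.take_succ_cons,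
    List.take_zero]
  rw [hF_apply, verdict, learnOut, OracleAlg.runIdx]
  rfl

/-- The global query sequence of the composite: the points of the intermediate queries. [folklore] -/
theorem flatMap_queries_midAlg (𝒪 : Oracle) (us : List (List Bool)) :
    (us.flatMap fun u => midAlg.queries 𝒪 2 u) = us.map List.tail := by
  induction us with
  | nil => rfl
  | cons u us ih => rw [List.flatMap_cons, List.map_cons, queries_midAlg 𝒪 u le_rfl, ih, List.singleton_append]

/-- **The run of `distCore`** against `𝒪` on the record: the verdict. [Ladner–Lynch–Selman 1975, §2;
Arora–Barak 2009, §3.4] [folklore] -/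
theorem run_distCore (𝒪 : Oracle) {K : ℕ} (hK : qA.eval (learnerInput P₁ P₂ n r).length + 3 ≤ K) :
    (distCore A E qA).run 𝒪 K (record P₁ P₂ n r) = some (verdict A E qA P₁ P₂ n r 𝒪) := by
  have hrun := run_learnerCore A E qA P₁ P₂ n r 𝒪 (le_refl (qA.eval (learnerInput P₁ P₂ n r).length + 3))
  obtain ⟨us, hlen, hstep, hout, hus⟩ :=
    (learnerCore A E qA).exists_trace_of_runAux (fMid 𝒪) (record P₁ P₂ n r) _ [] _ hrun
  simp only [List.nil_append] at hstep hout
  -- the queries of the core are rewritten queries, hence short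
  have hub : ∀ u ∈ us, u.length ≤ n + 1 := by
    intro u hu
    rw [← hus] at hu
    obtain ⟨as', q, rfl⟩ := exists_eq_of_mem_queriesAux_mapQuery _ dF (fMid 𝒪) (record P₁ P₂ n r) _ [] u hu
    rw [dF_apply]
    exact length_dMath_le _ _ _ _
  have hN : ∀ u ∈ us, midAlg.run 𝒪 2 u = some (fMid 𝒪 u) := fun u _ => run_midAlg 𝒪 u le_rfl
  have hQlen : (us.flatMap fun u => midAlg.queries 𝒪 2 u).length = us.length := by
    rw [flatMap_queries_midAlg, List.length_map]
  -- lengths: `n ≤ |x_A| ≤ |record|`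
  have hnxA : n ≤ (learnerInput P₁ P₂ n r).length := by rw [length_learnerInput]; omega
  have hxAxp : (learnerInput P₁ P₂ n r).length ≤ (record P₁ P₂ n r).length := by
    rw [record, length_boolPair]; omega
  have h := OracleComposition.compose_runAux_eq (eb := encodingBoolBool) 𝒪 (fMid 𝒪) 2
    (OracleComposition.prmOf (composeP qA)) (record P₁ P₂ n r) _ us hstep hout hN ?_ (K := K)
    (by rw [hQlen]; omega)
  · exact h.1
  intro j _ N hN'
  have hNxp : 2 * (record P₁ P₂ n r).length + 2 ≤ N := by rw [hN', OracleComposition.inputLength_eq]; omega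
  have hxAN : (learnerInput P₁ P₂ n r).length ≤ N := by omega
  have hqAN : qA.eval (learnerInput P₁ P₂ n r).length ≤ qA.eval N := TM2Iter.eval_mono qA hxAN
  have hP : (composeP qA).eval N = 3 * qA.eval N + N + 8 := by simp [composeP]
  have hbnd : (OracleComposition.prmOf (composeP qA)).bndOf N = 4 * N + (composeP qA).eval N + 4 := rfl
  have hpad : (OracleComposition.prmOf (composeP qA)).padOf N = 2 * (4 * N + (composeP qA).eval N + 4) := rfl
  have hiter : (composeP qA).eval N ≤ (OracleComposition.prmOf (composeP qA)).iterOf N := by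
    show _ ≤ OracleComposition.m₂Of (composeP qA) N
    simp only [OracleComposition.m₂Of, OracleComposition.m₁Of]
    nlinarith
  have hsum2 : (us.map fun u => (midAlg.queries 𝒪 2 u).length + 2).sum = 3 * us.length := by
    have : ∀ u ∈ us, (midAlg.queries 𝒪 2 u).length + 2 = 3 := fun u _ => by rw [queries_midAlg 𝒪 u le_rfl]; rfl
    rw [List.map_congr_left this, List.map_const', List.sum_replicate, smul_eq_mul, mul_comm]
  have hsum1 : (us.map fun u => (midAlg.queries 𝒪 2 u).length + 1).sum = 2 * us.length := by
    have : ∀ u ∈ us, (midAlg.queries 𝒪 2 u).length + 1 = 2 := fun u _ => by rw [queries_midAlg 𝒪 u le_rfl]; rfl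
    rw [List.map_congr_left this, List.map_const', List.sum_replicate, smul_eq_mul, mul_comm]
  refine ⟨fun u hu => ?_, fun u hu q hq => ?_, fun i hi _ => ?_, fun _ => ?_, ?_, ?_⟩
  · rw [hbnd]; have := hub u hu; omega
  · rw [hbnd]; rw [queries_midAlg 𝒪 u le_rfl, List.mem_singleton] at hq; subst hq
    have := hub u hu; have := List.length_tail (l := u); omega
  · rw [hbnd]; have h1 := length_fMid_le 𝒪 (us[i]); have h2 := hub _ (List.getElem_mem hi); omega
  · rw [hbnd]; show (encodeBool _).length ≤ _; simp [encodeBool]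
  · rw [hpad, hsum2]; omega
  · rw [hsum1]; omega

/-- `|x_A| ≤ inputBoundPoly(n)`. [folklore] -/
theorem length_learnerInput_le_inputBoundPoly : (learnerInput P₁ P₂ n r).length ≤ (inputBoundPoly P₁).eval n := by
  have h := length_learnerInput_le P₁ P₂ n r
  simp only [inputBoundPoly, rulerLen, eval_add, eval_mul, eval_ofNat, eval_X, eval_one] at h ⊢
  omega

/-- The round budget suffices: `qA(|x_A|) + 3 ≤ fuelPoly(n)`. [folklore] -/
theorem budget_le_fuelPoly : qA.eval (learnerInput P₁ P₂ n r).length + 3 ≤ (fuelPoly qA P₁).eval n := by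
  have h := TM2Iter.eval_mono qA (length_learnerInput_le_inputBoundPoly P₁ P₂ n r)
  simp only [fuelPoly, eval_add, eval_comp, eval_ofNat]
  omega

/-- **The deterministic run of the distinguisher**: on `1ⁿ` with coins `r`, against any oracle `𝒪`,
within its round budget it outputs the verdict. [GGM 1986, §3; Kearns–Valiant 1994, §3;
Oliveira–Santhanam 2017, §4 Prop. 1] [folklore] -/
theorem run_distinguisher (𝒪 : Oracle) {K : ℕ} (hK : (fuelPoly qA P₁).eval n ≤ K) :
    (distinguisher A E qA P₁ P₂).alg.run 𝒪 K (boolPair (unaryEncodeNat n) r) =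
      some (verdict A E qA P₁ P₂ n r 𝒪) := by
  change ((distCore A E qA).comap (preF P₁ P₂)).runAux 𝒪 (boolPair (unaryEncodeNat n) r) K [] = _
  rw [runAux_comap, preF_apply]
  exact run_distCore A E qA P₁ P₂ n r 𝒪 ((budget_le_fuelPoly qA P₁ P₂ n r).trans hK)

/-- **The acceptance probability of the distinguisher** on `1ⁿ` against `𝒪`: the fraction of coin
strings `r ∈ {0,1}^{coinsPoly(n)}` on which the verdict is `1`. [Goldreich 2001, §3.6 Def. 3.6.4] [folklore] -/
theorem acceptProb_distinguisher (𝒪 : Oracle) :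
    (distinguisher A E qA P₁ P₂).acceptProb 𝒪 n =
      uniformProb ((coinsPoly qA P₁ P₂).eval n) {l | verdict A E qA P₁ P₂ n l 𝒪 = true} := by
  rw [show (coinsPoly qA P₁ P₂).eval n = (distinguisher A E qA P₁ P₂).coins.eval (unaryEncodeNat n).length by
    rw [length_unaryEncodeNat]; rfl]
  rw [OracleAdversary.acceptProb, OracleAdversary.outputPMF_eq_map, ← PMF.toOuterMeasure_apply_singleton,
    PMF.toOuterMeasure_map_apply, uniformProb_eq_toOuterMeasure]
  congr 2
  ext v
  simp only [Set.mem_preimage, Set.mem_singleton_iff, Set.mem_setOf_eq]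
  rw [run_distinguisher A E qA P₁ P₂ n v.toList 𝒪 (by rw [length_unaryEncodeNat]; exact le_rfl)]
  simp

end Adversary

end LearnerDistinguisher

end Literature.Computability.Learning
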